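import Summits.QuantumFields.BalabanUV.Beta.FP.PerfectFeynmanSymbol
import Summits.QuantumFields.BalabanUV.Beta.FP.PerfectPolarization

/-!
# `BalabanUV.Beta.FP.PerfectPropagatorInverse` — road «FP» for binder row D1, leaf (H2), sub-row **H2-P-INVKER** of H2-ASM-5a (road-FP OWNER b2b-balaban-beta-d1-p3 gen 8,
# journal l.26457, `LEAVES-FP.md` l.445∕448∕453; first refusal this lineage), part 2∕2 = THE ROW: THE LETTER **(P-INV)** AS A THEOREM —
# «THE PERFECT PROPAGATOR INVERTS THE PERFECT FEYNMAN FORM ON THE FIELD BLOCK»: `comp Pker MF = idF` and `comp MF Pker = idF`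

HONEST DEPENDENCY (page 1, mandatory): continuum YM on T⁴ ⇐ BetaPertH ∧ nine spine estimates (0/9 proved); BetaPertH ⇐ (D1) ∧ (D4) ∧ CAP+tail;
G-an2-4 gates asym, D1 and NE2/3/4.  HONEST FRAMING (cell contract, verbatim): «discharging `BetaPertH` makes Bałaban's UV stability UNCONDITIONAL —
a real constructive-QFT result; it is NOT the continuum limit and NOT the Clay problem.»  THIS MODULE DISCHARGES NOTHING of the wall.  It turns ONE displayed
letter of `FP/PerfectPolarizationWard.wardTransversal_flip_PiBF`'s cone — the owner's (P-INV) «`comp Pker MF = idField ∧ comp MF Pker = idField` with `MF :=` the lattice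
kernel of the Feynman matrix symbol `feynMat (Re W_∞) (d1Sym)`» (l.26457) — into a kernel theorem about the road's EXPLICIT `k = ∞` objects (`PinfSym`, `W_∞`, `PinfKer`,
`Pker`), BY NAME over part 1 `FP/PerfectFeynmanSymbol` (two-point forms of the tree's `L¹` convolution theorem `CoarseCovarianceInverseKernel.tsum_latticeKernel_mul_of_integrableOn`, `feynSym`, its strip regularity,
`feynSym_ofReal`, `latticeKernel_sum_symP_mul_feynSym` ∕ `…_feynSym_mul_symP`, reality).  Two [our object] data definitions (`MF`, `idF`); no `def … : Prop`; nothing cited;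
0 sorry; 0∕4 row-D1 binders; NOT (W1) — that is «layer b»: (W1) ⟸ (a4-total) + (P-INV), next file —, NOT (K0), NOT hgerm, NOT D1, NOT BetaPertH, NOT continuum, NOT Clay.
«not in print; our bookkeeping over the road's own `k = ∞` objects».

ABSOLUTE RULE (cell charter, verbatim): «No internally-minted statement may enter as a cited fact. Every hypothesis is either kernel-proved in this package or a
verbatim quotation of a PUBLISHED theorem with page reference. The manuscript(s) under audit are NOT citable for their own disputed steps — they are the thing
under adjudication; programme-internal (2001/route/tribunal) claims are never citable.»

CONTENT (lattice dimension `3 + 1 = 4`, packed fibre `Fib 3`).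
* §4 [our object] **`MF : MKer 4 (Fib 3)`** — field block `MF x z (inl γ) (inl β) := Re K[feynSym γ β](z − x)` (the orientation of `PerfectPolarization.Pker_inl_inl`), every block
  touching a multiplier leg `0`; `MF_translate` (`shiftK v MF = MF`); **`decays_MF : ∃ C ≥ 0, Decays MF C (κ₁₆₆(4)∕4)`** (strip regularity of `feynSym`, `latticeKernel_decay`,
  `|·|₁ ≤ 4‖·‖∞`); **`idF : MKer 4 (Fib 3)`** `:= [z − x = 0 ∧ γ = β]` on the field block, `0` elsewhere; `idF_inl_inl_eq` (`= [x = z ∧ γ = β]`).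
* §5 THE ROW: `tsum_re_PinfKer_mul_re_feyn` ∕ `tsum_re_feyn_mul_re_PinfKer` (one field-block word = `Re K[symP α γ·feynSym γ β](z − x)`, resp. the mirrored product, by part 1's
  two-point forms at `P := symP α γ` — `integrableOn_symP_ofRealVec`, `3 ≤ 3 + 1` — and `S := feynSym γ β`, both kernels real), `summable_re_words`, and
  **`comp_Pker_MF : comp Pker MF = idF`**, **`comp_MF_Pker : comp MF Pker = idF`**, **`pInv : comp Pker MF = idF ∧ comp MF Pker = idF`** (`ExpKernelCalculus.comp`; the
  `Fib 3 = inl ⊕ inr` split kills every word with a multiplier leg — `Pker`'s and `MF`'s off-field blocks vanish —; tsum ∕ finite-sum exchange by `summable_re_words`;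
  `latticeKernel_finset_sum`; part 1's kernel identities).
* §6 (v1.1) DICTIONARY `MF_inl_inl_eq_deltaZLim(')`: `MF x z (inl γ) (inl β) = deltaZLim (z, γ) (x, β) + Re K[sliceSym γ β](z − x)` (= `deltaZLim (x, β) (z, γ) + …`) — H2-P-DICT
  `deltaZLim_eq_re_latticeKernel` BY NAME; the direction indices are read CROSSWISE (off-diagonal entry symbols are not real, so `≠ deltaZLim (x, γ) (z, β)` in general).
CONSUMER: «layer b» `FP/PerfectPolarizationWardLetters` — (W1) `(Pker ∘ divV V y) ∘ Pker = Pker ∘ X y − X y ∘ Pker` ⟸ (a4-total) `divV V y = c·(MF ∘ Π_y − Π_y ∘ MF)` + (P-INV),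
`X y = −c·Π_y`; (G-INV) for the ghost leg `G0ker` rides with it.
Provenance: G-an2-4 formalisation swarm seat b2b-balaban-gan24-formalise-leaf-02 gen 40 (prover-b2b-balaban-gan24-formalise-leaf-02-g40-0; cross-lane on road FP under R-FP-33 (c),
sub-row H2-P-INVKER of H2-ASM-5a, first refusal this lineage, owner b2b-balaban-beta-d1-p3 l.26457), 2026-08-21.
-/

noncomputable section

namespace Summit.QuantumFields.BalabanUV.Beta.FP.PerfectPropagatorInverse

open MeasureTheory Complex Set Filter Topology Finset
open scoped Real BigOperators
open Literature.MathematicalPhysics.QuantumFieldTheory.Balaban1983to89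
open Literature.MathematicalPhysics.QuantumFieldTheory.Balaban1983to89.Beta
open B4Strip (ofRealVec Strip)
open B4ContourShift (BZ phase integrand fourierBox latticeKernel StripRegular supNorm latticeKernel_decay)
open B5Symbol166Strip (kappa166 kappa166_pos)
open B12Sec2to5 (l1 l1_nonneg)
open ExpKernelCalculus (MKer Site comp shiftK Decays)
open OneStepResolventKernel (Fib)
open Summit.QuantumFields.BalabanUV.Beta.FP.PerfectMaxwellDict (latticeKernel_finset_sum)
open Summit.QuantumFields.BalabanUV.Beta.FP.PerfectPropagatorKernel (symP PinfKer)
open Summit.QuantumFields.BalabanUV.Beta.FP.PerfectPolarization (Pker Pker_inl_inl Pker_inl_inr Pker_inr_inl Pker_inr_inr)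
open Summit.QuantumFields.BalabanUV.Beta.FP.PerfectFeynmanSymbol (feynSym exists_stripRegular_feynSym PinfKer_eq_re latticeKernel_feynSym_eq_re
  integrableOn_integrand_symP_mul_feynSym integrableOn_integrand_feynSym_mul_symP latticeKernel_sum_symP_mul_feynSym latticeKernel_sum_feynSym_mul_symP
  tsum_latticeKernel_mul_sub_of_integrable tsum_latticeKernel_mul_sub_of_integrable' summable_latticeKernel_mul_sub_of_integrable integrableOn_symP_ofRealVec)

section Packed

/-- [our object] **THE PERFECT FEYNMAN FORM ON THE PACKED FIBRE**: field block `(x, z, inl γ, inl β) ↦ Re K[feynSym γ β](z − x)` (the orientation of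
`PerfectPolarization.Pker_inl_inl`), every block touching a multiplier leg `0`.  A definition asserting nothing. -/
def MF : MKer 4 (Fib 3) := fun x z a b =>
  match a, b with
  | Sum.inl γ, Sum.inl β => (latticeKernel (feynSym (d := 3) γ β) (z - x)).re
  | Sum.inl _, Sum.inr _ => 0
  | Sum.inr _, Sum.inl _ => 0
  | Sum.inr _, Sum.inr _ => 0

/-- [our object] the field block of `MF`. -/
@[simp] theorem MF_inl_inl (x z : Site 4) (γ β : Fin 4) : MF x z (Sum.inl γ) (Sum.inl β) = (latticeKernel (feynSym (d := 3) γ β) (z - x)).re := rfl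

/-- [our object] the field–multiplier block of `MF` vanishes. -/
@[simp] theorem MF_inl_inr (x z : Site 4) (γ b : Fin 4) : MF x z (Sum.inl γ) (Sum.inr b) = 0 := rfl

/-- [our object] the multiplier–field block of `MF` vanishes. -/
@[simp] theorem MF_inr_inl (x z : Site 4) (a β : Fin 4) : MF x z (Sum.inr a) (Sum.inl β) = 0 := rfl

/-- [our object] the multiplier block of `MF` vanishes. -/
@[simp] theorem MF_inr_inr (x z : Site 4) (a b : Fin 4) : MF x z (Sum.inr a) (Sum.inr b) = 0 := rfl

/-- [our object] `MF` is translation invariant. -/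
theorem MF_translate (v : Site 4) : shiftK v MF = MF := by
  funext x z a b
  show MF (x + v) (z + v) a b = MF x z a b
  rcases a with γ | γ <;> rcases b with β | β
  · simp only [MF_inl_inl, add_sub_add_right_eq_sub]
  · rfl
  · rfl
  · rfl

/-- [our object] **`MF` DECAYS EXPONENTIALLY** (strip regularity of `feynSym` on the (1.66) strip, `B4ContourShift.latticeKernel_decay`, `‖·‖∞ ≥ |·|₁∕4` on `ℤ⁴`):
`Decays MF C (κ₁₆₆(4)∕4)` for an explicit `C`. -/
theorem decays_MF : ∃ C, 0 ≤ C ∧ Decays MF C (kappa166 4 / 4) := by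
  classical
  choose M hM0 hM using fun γβ : Fin 4 × Fin 4 => exists_stripRegular_feynSym (d := 3) γβ.1 γβ.2
  refine ⟨∑ γβ : Fin 4 × Fin 4, M γβ, Finset.sum_nonneg fun i _ => hM0 i, ?_⟩
  intro x z a b
  rcases a with γ | γ <;> rcases b with β | β
  · rw [MF_inl_inl]
    have h1 := latticeKernel_decay (hM (γ, β)) (kappa166_pos 4).le (z - x)
    have h2 : |(latticeKernel (feynSym (d := 3) γ β) (z - x)).re| ≤ ‖latticeKernel (feynSym (d := 3) γ β) (z - x)‖ := Complex.abs_re_le_norm _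
    have h3 : M (γ, β) ≤ ∑ γβ : Fin 4 × Fin 4, M γβ := Finset.single_le_sum (fun i _ => hM0 i) (Finset.mem_univ (γ, β))
    have h4 : Real.exp (-(kappa166 4 * supNorm (z - x))) ≤ Real.exp (-(kappa166 4 / 4) * l1 (x - z)) := by
      apply Real.exp_le_exp.mpr
      have hl : l1 (x - z) ≤ 4 * supNorm (z - x) := by
        have h5 := B4TorusKernel.sum_abs_le_mul_supNorm (z - x)
        have e : l1 (x - z) = ∑ i, ((|(z - x) i| : ℤ) : ℝ) := by
          unfold l1
          refine Finset.sum_congr rfl fun i _ => ?_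
          rw [Int.cast_abs, Pi.sub_apply, Pi.sub_apply, Int.cast_sub, Int.cast_sub, abs_sub_comm]
        rw [e]
        norm_num at h5 ⊢
        linarith
      nlinarith [kappa166_pos 4]
    calc |(latticeKernel (feynSym (d := 3) γ β) (z - x)).re| ≤ M (γ, β) * Real.exp (-(kappa166 4 * supNorm (z - x))) := h2.trans h1
      _ ≤ (∑ γβ : Fin 4 × Fin 4, M γβ) * Real.exp (-(kappa166 4 / 4) * l1 (x - z)) :=
          mul_le_mul h3 h4 (Real.exp_pos _).le (Finset.sum_nonneg fun i _ => hM0 i)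
  all_goals
    show |(0 : ℝ)| ≤ _
    rw [abs_zero]; exact mul_nonneg (Finset.sum_nonneg fun i _ => hM0 i) (Real.exp_pos _).le

/-- [our object] **THE FIELD-BLOCK IDENTITY** `idF (x, z, a, b) := [x = z]·[a = b ∈ field block]`.  A definition asserting nothing. -/
def idF : MKer 4 (Fib 3) := fun x z a b =>
  match a, b with
  | Sum.inl γ, Sum.inl β => if z - x = 0 ∧ γ = β then 1 else 0
  | Sum.inl _, Sum.inr _ => 0
  | Sum.inr _, Sum.inl _ => 0
  | Sum.inr _, Sum.inr _ => 0

/-- [our object] the field block of `idF`. -/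
@[simp] theorem idF_inl_inl (x z : Site 4) (γ β : Fin 4) : idF x z (Sum.inl γ) (Sum.inl β) = if z - x = 0 ∧ γ = β then 1 else 0 := rfl

/-- [our object] off the field block `idF` vanishes. -/
@[simp] theorem idF_inl_inr (x z : Site 4) (γ b : Fin 4) : idF x z (Sum.inl γ) (Sum.inr b) = 0 := rfl

/-- [our object] off the field block `idF` vanishes. -/
@[simp] theorem idF_inr_inl (x z : Site 4) (a β : Fin 4) : idF x z (Sum.inr a) (Sum.inl β) = 0 := rfl

/-- [our object] off the field block `idF` vanishes. -/
@[simp] theorem idF_inr_inr (x z : Site 4) (a b : Fin 4) : idF x z (Sum.inr a) (Sum.inr b) = 0 := rfl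

/-- [our object] `idF` in words: the identity on the field block, `[x = z]·[γ = β]`. -/
theorem idF_inl_inl_eq (x z : Site 4) (γ β : Fin 4) : idF x z (Sum.inl γ) (Sum.inl β) = if x = z ∧ γ = β then 1 else 0 := by
  rw [idF_inl_inl]
  by_cases h : x = z
  · simp [h]
  · have h' : ¬ (z - x = 0) := fun e => h (sub_eq_zero.mp e).symm
    simp [h, h']

end Packed

/-! ## §5 THE ROW (P-INV): `comp Pker MF = idF` and `comp MF Pker = idF` -/

section Row

/-- [folklore] a real-part reading of one field-block word: `Σ'_y Re PinfKer α γ (y − x) · Re K[feynSym γ β](z − y) = Re K[symP α γ · feynSym γ β](z − x)`. -/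
theorem tsum_re_PinfKer_mul_re_feyn (α γ β : Fin 4) (x z : Site 4) :
    ∑' y : Site 4, (PinfKer (d := 3) α γ (y - x)).re * (latticeKernel (feynSym (d := 3) γ β) (z - y)).re
      = (latticeKernel (fun p => symP (d := 3) α γ p * feynSym γ β p) (z - x)).re := by
  obtain ⟨M, _, hM⟩ := exists_stripRegular_feynSym (d := 3) γ β
  have h := tsum_latticeKernel_mul_sub_of_integrable (integrableOn_symP_ofRealVec (d := 3) (by norm_num) α γ) hM (kappa166_pos 4) x z
  have e : ∀ y : Site 4, latticeKernel (symP (d := 3) α γ) (y - x) * latticeKernel (feynSym (d := 3) γ β) (z - y) =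
      ((((PinfKer (d := 3) α γ (y - x)).re * (latticeKernel (feynSym (d := 3) γ β) (z - y)).re : ℝ)) : ℂ) := by
    intro y
    rw [Complex.ofReal_mul, ← PinfKer_eq_re, ← latticeKernel_feynSym_eq_re]
    rfl
  rw [tsum_congr e, ← Complex.ofReal_tsum] at h
  have h' := congrArg Complex.re h
  rw [Complex.ofReal_re] at h'
  exact h'

/-- [folklore] the mirrored word: `Σ'_y Re K[feynSym α γ](y − x) · Re PinfKer γ β (z − y) = Re K[feynSym α γ · symP γ β](z − x)`. -/
theorem tsum_re_feyn_mul_re_PinfKer (α γ β : Fin 4) (x z : Site 4) :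
    ∑' y : Site 4, (latticeKernel (feynSym (d := 3) α γ) (y - x)).re * (PinfKer (d := 3) γ β (z - y)).re
      = (latticeKernel (fun p => feynSym (d := 3) α γ p * symP γ β p) (z - x)).re := by
  obtain ⟨M, _, hM⟩ := exists_stripRegular_feynSym (d := 3) α γ
  have h := tsum_latticeKernel_mul_sub_of_integrable' (integrableOn_symP_ofRealVec (d := 3) (by norm_num) γ β) hM (kappa166_pos 4) x z
  have e : ∀ y : Site 4, latticeKernel (feynSym (d := 3) α γ) (y - x) * latticeKernel (symP (d := 3) γ β) (z - y) =
      ((((latticeKernel (feynSym (d := 3) α γ) (y - x)).re * (PinfKer (d := 3) γ β (z - y)).re : ℝ)) : ℂ) := by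
    intro y
    rw [Complex.ofReal_mul, ← PinfKer_eq_re, ← latticeKernel_feynSym_eq_re]
    rfl
  rw [tsum_congr e, ← Complex.ofReal_tsum] at h
  have h' := congrArg Complex.re h
  rw [Complex.ofReal_re] at h'
  exact h'

/-- [folklore] summability of the two real-part words (bounded `PinfKer` leg × exponentially decaying `K[feynSym]` leg). -/
theorem summable_re_words (α γ β : Fin 4) (x z : Site 4) :
    Summable (fun y : Site 4 => (PinfKer (d := 3) α γ (y - x)).re * (latticeKernel (feynSym (d := 3) γ β) (z - y)).re) ∧
      Summable (fun y : Site 4 => (latticeKernel (feynSym (d := 3) α γ) (y - x)).re * (PinfKer (d := 3) γ β (z - y)).re) := by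
  obtain ⟨M, _, hM⟩ := exists_stripRegular_feynSym (d := 3) γ β
  obtain ⟨M', _, hM'⟩ := exists_stripRegular_feynSym (d := 3) α γ
  have h1 := (summable_latticeKernel_mul_sub_of_integrable (symP (d := 3) α γ) hM (kappa166_pos 4) x z).1
  have h2 := (summable_latticeKernel_mul_sub_of_integrable (symP (d := 3) γ β) hM' (kappa166_pos 4) x z).2
  constructor
  · refine Summable.of_norm_bounded h1.norm fun y => ?_
    rw [Real.norm_eq_abs, abs_mul, norm_mul]
    exact mul_le_mul (Complex.abs_re_le_norm _) (Complex.abs_re_le_norm _) (abs_nonneg _) (norm_nonneg _)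
  · refine Summable.of_norm_bounded h2.norm fun y => ?_
    rw [Real.norm_eq_abs, abs_mul, norm_mul]
    exact mul_le_mul (Complex.abs_re_le_norm _) (Complex.abs_re_le_norm _) (abs_nonneg _) (norm_nonneg _)

/-- [our object] **(P-INV), FIRST HALF: `comp Pker MF = idF`** — the perfect BF-Feynman propagator is a LEFT inverse of the perfect Feynman form on the field block. -/
theorem comp_Pker_MF : comp Pker MF = idF := by
  funext x z a b
  unfold comp
  rcases a with α | α <;> rcases b with β | β
  · simp only [Fintype.sum_sum_type, Pker_inl_inl, MF_inl_inl, Pker_inl_inr, MF_inr_inl, mul_zero, Finset.sum_const_zero, add_zero, idF_inl_inl]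
    rw [Summable.tsum_finsetSum (fun γ _ => (summable_re_words α γ β x z).1)]
    simp_rw [tsum_re_PinfKer_mul_re_feyn]
    rw [← Complex.re_sum, ← latticeKernel_finset_sum Finset.univ (fun γ _ => integrableOn_integrand_symP_mul_feynSym (by norm_num) α γ β (z - x)),
      latticeKernel_sum_symP_mul_feynSym]
    split_ifs <;> simp
  · simp only [Fintype.sum_sum_type, Pker_inl_inl, MF_inl_inr, Pker_inl_inr, MF_inr_inr, mul_zero, Finset.sum_const_zero, add_zero, tsum_zero,
      idF_inl_inr]
  · simp only [Fintype.sum_sum_type, Pker_inr_inl, Pker_inr_inr, zero_mul, Finset.sum_const_zero, add_zero, tsum_zero, idF_inr_inl]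
  · simp only [Fintype.sum_sum_type, Pker_inr_inl, Pker_inr_inr, zero_mul, Finset.sum_const_zero, add_zero, tsum_zero, idF_inr_inr]

/-- [our object] **(P-INV), SECOND HALF: `comp MF Pker = idF`** — … and a RIGHT inverse. -/
theorem comp_MF_Pker : comp MF Pker = idF := by
  funext x z a b
  unfold comp
  rcases a with α | α <;> rcases b with β | β
  · simp only [Fintype.sum_sum_type, Pker_inl_inl, MF_inl_inl, Pker_inr_inl, MF_inl_inr, mul_zero, Finset.sum_const_zero, add_zero, idF_inl_inl]
    rw [Summable.tsum_finsetSum (fun γ _ => (summable_re_words α γ β x z).2)]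
    simp_rw [tsum_re_feyn_mul_re_PinfKer]
    rw [← Complex.re_sum, ← latticeKernel_finset_sum Finset.univ (fun γ _ => integrableOn_integrand_feynSym_mul_symP (by norm_num) α γ β (z - x)),
      latticeKernel_sum_feynSym_mul_symP]
    split_ifs <;> simp
  · simp only [Fintype.sum_sum_type, MF_inl_inl, Pker_inl_inr, MF_inl_inr, Pker_inr_inr, mul_zero, Finset.sum_const_zero, add_zero, tsum_zero,
      idF_inl_inr]
  · simp only [Fintype.sum_sum_type, MF_inr_inl, MF_inr_inr, zero_mul, Finset.sum_const_zero, add_zero, tsum_zero, idF_inr_inl]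
  · simp only [Fintype.sum_sum_type, MF_inr_inl, MF_inr_inr, zero_mul, Finset.sum_const_zero, add_zero, tsum_zero, idF_inr_inr]

/-- [our object] **(P-INV)** packaged as the owner wrote it (l.26457). -/
theorem pInv : comp Pker MF = idF ∧ comp MF Pker = idF := ⟨comp_Pker_MF, comp_MF_Pker⟩

end Row

/-! ## §6 (v1.1) DICTIONARY: the field block of `MF` in the tree's `Δ_∞` currency -/

section Dictionary

open B4Strip (ofRealVec)
open B4ContourShift (integrand ofRealVec_mem_Strip)
open B5Symbol166Strip (expFacNeg expFacPos stripRegular_expFacNeg stripRegular_expFacPos)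
open Summit.QuantumFields.BalabanUV.Beta.GAN24.EffectiveLaplacianLimit (deltaZLim deltaZLim_symm)
open Summit.QuantumFields.BalabanUV.Beta.FP.PerfectSymbolKMultiplierClosed (GsymInf)
open Summit.QuantumFields.BalabanUV.Beta.FP.PerfectMaxwellDict (bondSymbol deltaZLim_eq_re_latticeKernel latticeKernel_add)
open Summit.QuantumFields.BalabanUV.Beta.FP.PerfectFeynmanSymbol (sliceSym feynSym_def exists_stripRegular_bondSymbol_GsymInf)

/-- [our object] **THE FIELD BLOCK OF `MF` IS BAŁABAN's `Δ_∞` PLUS THE `ξ = 1` SLICE, IN THE TREE's BOND-BASIS CURRENCY — WITH THE DIRECTION INDICES READ CROSSWISE**: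
`MF x z (inl γ) (inl β) = deltaZLim (z, γ) (x, β) + Re K[sliceSym γ β](z − x)` (H2-P-DICT `PerfectMaxwellDict.deltaZLim_eq_re_latticeKernel` at `b := (z, γ)`, `b′ := (x, β)`:
`deltaZLim b b′ = Re K[bondSymbol GsymInf b.2 b′.2](b.1 − b′.1)`).  Recorded so that the (a4-total) letter's `MF` is unambiguous for the H2V-4 prover; note that
`deltaZLim (z, γ) (x, β) = deltaZLim (x, β) (z, γ)` (`deltaZLim_symm`) is in general NOT `deltaZLim (x, γ) (z, β)` (the off-diagonal entry symbols are not real). -/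
theorem MF_inl_inl_eq_deltaZLim (x z : Site 4) (γ β : Fin 4) :
    MF x z (Sum.inl γ) (Sum.inl β) = deltaZLim (d := 3) (z, γ) (x, β) + (latticeKernel (sliceSym (d := 3) γ β) (z - x)).re := by
  obtain ⟨M, _, hM⟩ := exists_stripRegular_bondSymbol_GsymInf (d := 3) (kappa166_pos 4).le le_rfl γ β
  have h1 : IntegrableOn (integrand (bondSymbol (GsymInf (d := 3 + 1)) γ β) (z - x)) (BZ (3 + 1)) := hM.integrableOn (kappa166_pos 4).le (z - x)
  have h2 : IntegrableOn (integrand (sliceSym (d := 3) γ β) (z - x)) (BZ (3 + 1)) :=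
    ((stripRegular_expFacPos (d := 3) γ (kappa166 4)).mul (stripRegular_expFacNeg (d := 3) β (kappa166 4)) (by positivity)).integrableOn
      (kappa166_pos 4).le (z - x)
  rw [MF_inl_inl, deltaZLim_eq_re_latticeKernel]
  show (latticeKernel (feynSym (d := 3) γ β) (z - x)).re = (latticeKernel (bondSymbol (GsymInf (d := 3 + 1)) γ β) (z - x)).re + _
  rw [show feynSym (d := 3) γ β = fun p => bondSymbol GsymInf γ β p + sliceSym γ β p from funext fun p => feynSym_def γ β p,
    latticeKernel_add h1 h2, Complex.add_re]

/-- [our object] the same with `deltaZLim`'s arguments in the `(x, ·) (z, ·)` order: `MF x z (inl γ) (inl β) = deltaZLim (x, β) (z, γ) + Re K[sliceSym γ β](z − x)`. -/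
theorem MF_inl_inl_eq_deltaZLim' (x z : Site 4) (γ β : Fin 4) :
    MF x z (Sum.inl γ) (Sum.inl β) = deltaZLim (d := 3) (x, β) (z, γ) + (latticeKernel (sliceSym (d := 3) γ β) (z - x)).re := by
  rw [MF_inl_inl_eq_deltaZLim, deltaZLim_symm]

end Dictionary

end Summit.QuantumFields.BalabanUV.Beta.FP.PerfectPropagatorInverse

end
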